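import Literature.LinearAlgebra.Matrix.MinkowskiDet
import Mathlib.Analysis.Convex.Integral
import Mathlib.Analysis.CStarAlgebra.Matrix
import Mathlib.Topology.Instances.Matrix
import HarnessLib

/-!
# Jensen's inequality for `det^{1/N}`: the mollification step of Compensated Integrability

For a probability measure `μ` and an integrable field of real positive semidefinite `N × N`
matrices `A(x) ⪰ 0`,

`∫ (det A(x))^{1/N} dμ(x) ≤ (det ∫ A(x) dμ(x))^{1/N}`.

This is Jensen's inequality for the concave function `det^{1/N}` on the (closed, convex)
positive semidefinite cone (`Literature.LinearAlgebra.Matrix.concaveOn_det_rpow`, Minkowski's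
determinant inequality) — exactly the inequality `det(ρ_ε ⋆ A)^{1/n} ≥ ρ_ε ⋆ (det A)^{1/n}` of the
smoothing Lemma 7 of D. Serre's Compensated Integrability on tori (Serre 2024, §2.1: "we recall
that `det^{1/n}` is a concave function over `Sym⁺_n`"), with `μ = ρ_ε(x - ·) dy`.

* `isClosed_setOf_posSemidef` — the real positive semidefinite cone is closed;
* `continuous_det_rpow` — `A ↦ (det A)^p` is continuous for `p ≥ 0`;
* **`integral_det_rpow_le_det_rpow_integral`** — the matrix Jensen inequality above
  (Mathlib's `ConcaveOn.le_map_integral`).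

The Bochner integral of matrices uses the `L²`-operator norm instances
(`open scoped Matrix.Norms.L2Operator`, whose topology is the product topology).

## References

* D. Serre, *Compensated integrability on tori; a priori estimate for space-periodic gas flows*,
  C. R. Math. Acad. Sci. Paris 362 (2024) 1425–1444, §2.1 Lemma 7. [Serre2024]
-/

open Matrix MeasureTheory
open scoped MatrixOrder Matrix.Norms.L2Operator

namespace Literature.LinearAlgebra.Matrix

variable {n : Type*} [Fintype n] [DecidableEq n]

omit [DecidableEq n] in
/-- The cone of real positive semidefinite matrices is closed (an intersection of the closed
conditions `Aᵀ = A` and `0 ≤ xᵀ A x`). [folklore] -/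
theorem isClosed_setOf_posSemidef : IsClosed {A : Matrix n n ℝ | A.PosSemidef} := by
  have hset : {A : Matrix n n ℝ | A.PosSemidef} =
      {A : Matrix n n ℝ | Aᴴ = A} ∩ ⋂ x : n → ℝ, {A : Matrix n n ℝ | 0 ≤ star x ⬝ᵥ (A *ᵥ x)} := by
    ext A
    simp only [Set.mem_setOf_eq, Set.mem_inter_iff, Set.mem_iInter, posSemidef_iff_dotProduct_mulVec,
      IsHermitian]
  rw [hset]
  refine (isClosed_eq continuous_id.matrix_conjTranspose continuous_id).inter
    (isClosed_iInter fun x => isClosed_le continuous_const ?_)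
  exact continuous_const.dotProduct (continuous_id.matrix_mulVec continuous_const)

omit [DecidableEq n] in
/-- `A ↦ (det A)^p` is continuous on real matrices for `p ≥ 0`. [folklore] -/
theorem continuous_det_rpow [DecidableEq n] {p : ℝ} (hp : 0 ≤ p) :
    Continuous fun A : Matrix n n ℝ => A.det ^ p :=
  (continuous_id.matrix_det).rpow_const fun _ => Or.inr hp

/-- **Jensen's inequality for `det^{1/N}`** (the mollification step of compensated integrability,
Serre 2024 Lemma 7): for a probability measure `μ` and an integrable field `A(x) ⪰ 0` of real
`N × N` matrices (`N ≥ 1`) with `x ↦ (det A(x))^{1/N}` integrable,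
`∫ (det A)^{1/N} dμ ≤ (det ∫ A dμ)^{1/N}`. [cite: Serre2024, §2.1 Lemma 7] -/
theorem integral_det_rpow_le_det_rpow_integral [Nonempty n] {X : Type*} [MeasurableSpace X]
    {μ : Measure X} [IsProbabilityMeasure μ] {A : X → Matrix n n ℝ}
    (hA : ∀ᵐ x ∂μ, (A x).PosSemidef) (hAi : Integrable A μ)
    (hdi : Integrable (fun x => (A x).det ^ (1 / (Fintype.card n : ℝ))) μ) :
    ∫ x, (A x).det ^ (1 / (Fintype.card n : ℝ)) ∂μ ≤
      (∫ x, A x ∂μ).det ^ (1 / (Fintype.card n : ℝ)) :=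
  (concaveOn_det_rpow (n := n)).le_map_integral
    (continuous_det_rpow (by positivity)).continuousOn isClosed_setOf_posSemidef hA hAi hdi

/-- The integral of an a.e. positive semidefinite integrable matrix field is positive
semidefinite (closedness and convexity of the cone; Mathlib `Convex.integral_mem`). [folklore] -/
theorem posSemidef_integral {X : Type*} [MeasurableSpace X] {μ : Measure X}
    [IsProbabilityMeasure μ] {A : X → Matrix n n ℝ} (hA : ∀ᵐ x ∂μ, (A x).PosSemidef)
    (hAi : Integrable A μ) : (∫ x, A x ∂μ).PosSemidef :=
  convex_setOf_posSemidef.integral_mem isClosed_setOf_posSemidef hA hAi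

end Literature.LinearAlgebra.Matrix
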